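import HarnessLib

/-!
# NOT A LINE — pointer only

`Lines/strategist_s3_sketch.lean` was written here by mistake (strategist seat s3, 2026-08-17). It is NOT a
skeleton (no `stub_*`, no `PolyhedralDssProfileExists_of`, never registered with `ledger skeleton check`).
The strategist's typed evidence lives at the crux top level:
`Cruxes/PolyhedralDssProfileExists/StrategistSketchS3.lean` (D2 Newton–Kantorovich split with proved assembly
`crux_of_nk` and collapse `nkCertificate_of_crux`, strengthening `NondegenerateCellExists`, weaker intermediate
`SectorFreeTypeIDssProfileExists`), referenced from `STRATEGY-CENSUS-s3.md`. Leads: ignore this file.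
-/
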